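import Literature.NumberTheory.Automorphic.UnitaryGroupUnipotentUnimodularThree   -- ★ `isMulRightInvariant_of_isHaarMeasure_adelicUnipotent_three`, fundamental-domain measures
import Literature.NumberTheory.Automorphic.OrbitalIntegralCosetUnfolding          -- ★ `isInvInvariant_of_isHaarMeasure_of_isMulRightInvariant`
import Literature.NumberTheory.Automorphic.UnipotentTateDomain                    -- ★ `t2Space_adeleRing` (Hausdorff adeles)
import HarnessLib

/-!
# h413 ∕ Track B «K2-LIT», «EIS-RANK-ONE» (D2-e) brick (ν-2) — `K2E1HeisenbergHaarU3`: the Haar measure of the adelic Heisenberg radical `N(𝔸)` of `U(J₃)`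
# is INVERSION-INVARIANT, and a fundamental domain of `N(L⁺)∖N(𝔸)` has measure `≠ 0` and `≠ ⊤` — the `[νN.IsInvInvariant]`, `h𝓕₀`, `h𝓕top` binders of
# ★ `K2E1EisensteinMinusConstantTermCuspBoundU3.forall_norm_sub_borelConstantTerm_le_three`, discharged BY NAME for every Haar `νN`

Cell `pub/hodgecm-mathlib`, crux H413 = `stmt-HodgeConjecture-24833`; dealer K2E1-plan (g4) RULING «(D2-e) SPLIT» 2026-09-04T06:25:32Z (bricks (ν-1)(ν-2) → desk
K2-defs1 (g4); assembly (D2-e)-A → K2E4-p11 (g3)).  THEOREMS ONLY (no `def`, no `instance`, no notation, no named fact, no `sorry`); lane `--kind proof --supports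
stmt-HodgeConjecture-24833 --as helper` (count-neutral).  The N = 2 twin is ★ `K2E1UnipotentHaarNormalisationU2` §3 (`isInvInvariant_of_isHaarMeasure_two`, there by
commutativity of `N(𝔸) ≅ 𝔸_E⁻`); the rank-3 radical is HEISENBERG (non-abelian), so inversion invariance is taken from UNIMODULARITY instead:
* `measure_fundamentalDomain_ne_zero_and_ne_top_three` — `νN 𝓕 ≠ 0 ∧ νN 𝓕 ≠ ⊤` for every `νN`-fundamental domain `𝓕` of the lattice `N(L⁺)` (★
  `measure_ne_zero_of_isFundamentalDomain_rationalUnipotent`, ★ `measure_lt_top_of_isFundamentalDomain_rationalUnipotent_three` — cocompactness of the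
  Heisenberg lattice [DeitmarEchterhoff2014, Thm. 9.1.6]);
* `locallyCompactSpace_and_secondCountableTopology_adelicUnipotent_three` — `N(𝔸)` is a closed subgroup of the locally compact second-countable `G(𝔸)`
  (Mathlib `isClosed_upperUnitriangular` over the Hausdorff adele ring, ★ `t2Space_adeleRing`);
* **`isInvInvariant_of_isHaarMeasure_adelicUnipotent_three`** — every Haar measure on `N(𝔸)` is inversion-invariant: it is right-invariant (★
  `isMulRightInvariant_of_isHaarMeasure_adelicUnipotent_three`: a group with a lattice is unimodular), and a left- and right-invariant Haar measure of a
  second-countable locally compact group is inversion-invariant (★ `isInvInvariant_of_isHaarMeasure_of_isMulRightInvariant` [Folland1995, §2.4]).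
HONEST LABEL: HC_CM is proved only modulo the 7 printed citations (2 remaining named inputs: hLiu418 = `stmt-HodgeConjecture-24832`, h413 =
`stmt-HodgeConjecture-24833`) until rung 0 closes; count-neutral helper (binders of the EIS-RANK-ONE campaign's (D2-e)), closes no socket.
References: [DeitmarEchterhoff2014] A. Deitmar, S. Echterhoff, *Principles of Harmonic Analysis*, 2nd ed. (2014), Thm. 9.1.6, §1.5; [Folland1995] G. Folland,
*A Course in Abstract Harmonic Analysis* (1995), §2.4; [MoeglinWaldspurger1995] I.2.1; [Rogawski1990] §2.1 p. 11.
-/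

set_option autoImplicit false
set_option linter.dupNamespace false  -- the mandated namespace repeats the summit's segment (`HodgeConjecture.HodgeConjecture`)

noncomputable section

open MeasureTheory Measure NumberField IsDedekindDomain Topology
open Literature.NumberTheory.Automorphic Literature.NumberTheory.Automorphic.UnitaryGroup
open scoped ENNReal MatrixGroups

namespace Summit.HodgeConjecture.HodgeConjecture.Cruxes.H413.K2E1HeisenbergHaarU3

variable {F E : Type} [Field F] [NumberField F] [Field E] [NumberField E] [Algebra F E] {c : E ≃ₐ[F] E}

/-- **`N(𝔸)` is a locally compact, second-countable group** (any `N`): a closed subgroup (Mathlib `isClosed_upperUnitriangular`, the adele ring is Hausdorff —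
★ `t2Space_adeleRing`) of the locally compact second-countable `G(𝔸) = (quasiSplit F E c N).Adelic`. [cite: DeitmarEchterhoff2014, §1.5] -/
theorem locallyCompactSpace_and_secondCountableTopology_adelicUnipotent {N : ℕ} :
    LocallyCompactSpace ↥(adelicUnipotent F E c N) ∧ SecondCountableTopology ↥(adelicUnipotent F E c N) := by
  haveI := secondCountableTopology_adeleRing E
  haveI := locallyCompactSpace_adeleRing' E
  haveI := t2Space_adeleRing E
  haveI : LocallyCompactSpace (quasiSplit F E c N).Adelic :=
    inferInstanceAs (LocallyCompactSpace (adelic F E c N ((StdForm.antidiagonal N).over E)))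
  haveI : SecondCountableTopology (quasiSplit F E c N).Adelic :=
    inferInstanceAs (SecondCountableTopology (adelic F E c N ((StdForm.antidiagonal N).over E)))
  have hcl : IsClosed ((adelicUnipotent F E c N : Set (quasiSplit F E c N).Adelic)) := by
    change IsClosed (⇑(adelicVal F E c N ((StdForm.antidiagonal N).over E)) ⁻¹'
      ((upperUnitriangular (Fin N) (AdeleRing (𝓞 E) E) : Subgroup (GL (Fin N) (AdeleRing (𝓞 E) E))) :
        Set (GL (Fin N) (AdeleRing (𝓞 E) E))))
    exact (isClosed_upperUnitriangular (R := AdeleRing (𝓞 E) E)).preimage continuous_subtype_val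
  exact ⟨hcl.locallyCompactSpace, TopologicalSpace.Subtype.secondCountableTopology _⟩

variable [MeasurableSpace ↥(adelicUnipotent F E c 3)] [BorelSpace ↥(adelicUnipotent F E c 3)]

/-- **A fundamental domain of `N(L⁺)∖N(𝔸)` (rank 3, Heisenberg radical) has measure `≠ 0` and `≠ ⊤`** for every Haar `νN` — the binders `h𝓕₀`, `h𝓕top` of ★
`forall_norm_sub_borelConstantTerm_le_three` (★ `measure_ne_zero_of_isFundamentalDomain_rationalUnipotent`, ★ `measure_lt_top_of_isFundamentalDomain_rationalUnipotent_three`).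
[cite: DeitmarEchterhoff2014, Thm. 9.1.6] [cite: MoeglinWaldspurger1995, I.2.1] -/
theorem measure_fundamentalDomain_ne_zero_and_ne_top_three (hc : c * c = 1) (νN : Measure ↥(adelicUnipotent F E c 3)) [νN.IsHaarMeasure]
    {𝓕 : Set ↥(adelicUnipotent F E c 3)} (h𝓕 : IsFundamentalDomain ↥(rationalUnipotent F E c 3) 𝓕 νN) :
    νN 𝓕 ≠ 0 ∧ νN 𝓕 ≠ ⊤ :=
  ⟨measure_ne_zero_of_isFundamentalDomain_rationalUnipotent νN h𝓕, (measure_lt_top_of_isFundamentalDomain_rationalUnipotent_three hc νN h𝓕).ne⟩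

/-- **EVERY HAAR MEASURE ON THE ADELIC HEISENBERG RADICAL `N(𝔸)` OF `U(J₃)` IS INVERSION-INVARIANT** — the instance binder `[νN.IsInvInvariant]` of ★
`forall_norm_sub_borelConstantTerm_le_three` for every Haar `νN`: `νN` is right-invariant (★ `isMulRightInvariant_of_isHaarMeasure_adelicUnipotent_three` — `N(𝔸)`
carries the cocompact lattice `N(L⁺)`, hence is unimodular), and a bi-invariant Haar measure of a second-countable locally compact group is inversion-invariant
(★ `isInvInvariant_of_isHaarMeasure_of_isMulRightInvariant`: `νN.inv = c • νN` with `c² = 1`). [cite: Folland1995, §2.4] [cite: DeitmarEchterhoff2014, Thm. 9.1.6] -/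
theorem isInvInvariant_of_isHaarMeasure_adelicUnipotent_three (hc : c * c = 1) (νN : Measure ↥(adelicUnipotent F E c 3)) [νN.IsHaarMeasure] :
    νN.IsInvInvariant := by
  obtain ⟨h₁, h₂⟩ := locallyCompactSpace_and_secondCountableTopology_adelicUnipotent (F := F) (E := E) (c := c) (N := 3)
  haveI := h₁
  haveI := h₂
  haveI := isMulRightInvariant_of_isHaarMeasure_adelicUnipotent_three hc νN
  exact isInvInvariant_of_isHaarMeasure_of_isMulRightInvariant νN

end Summit.HodgeConjecture.HodgeConjecture.Cruxes.H413.K2E1HeisenbergHaarU3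

end
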